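import Mathlib
import Literature.Probability.Percolation.Percolation
import Literature.Probability.Percolation.IkhlefPonsaingFirstPassage
import HarnessLib

/-!
# Stub `stub_ipRecursion_of_ikhlefPonsaing` (line `ip-passage-stirling`, crux
`CardyBoundaryCoulombGas.HalfPlaneOneArmThird`, stmt-CriticalPhenomena-5662)

The BRIDGE from the tree's named fact `Literature.Probability.Percolation.IkhlefPonsaingFirstPassage`
(Ikhlef–Ponsaing, J. Stat. Phys. 149 (2012), arXiv:1202.5476, Prop. 4.7: the wall-passage
probability of the diagonal bond-percolation strip at `p = 1/2` in closed form
`P_b(2m+1) = A_V(2m+1) A_V(2m+3) / N_8(2m+2)²`, with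
`A_V(2m+1) = ∏_{i<m} a_i`, `a_i = (3i+2)(6i+3)!(2i+1)!/((4i+2)!(4i+3)!)` and
`N_8(2m) = ∏_{i<m} n_i`, `n_i = (3i+1)(6i)!(2i)!/((4i)!(4i+1)!)`) to the two-step RECURSION
`P_b(2m+3) · (3m+4)(4m+7)(6m+5) = P_b(2m+1) · (3m+5)(4m+3)(6m+7)` used by the line.

Proof: specialise the fact at `b = (2m, 0)` (level `m`) and `b = (2m+2, 0)` (level `m+1`);
`Finset.prod_range_succ` reduces the quotient of the two closed forms to
`a_m a_{m+1} / n_{m+1}²`, and the CORE IDENTITY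
`a_m a_{m+1} (3m+4)(4m+7)(6m+5) = n_{m+1}² (3m+5)(4m+3)(6m+7)` is a finite factorial identity:
writing every factorial as a product of linear factors times `(6m+3)!`, `(2m+1)!`, `(4m+2)!`
(`cast_factorial_add`), it is a polynomial identity in `m` (closed by `field_simp; ring`).
Pure algebra; the fact enters only as the antecedent of the implication.
-/

noncomputable section

namespace Summit.CriticalPhenomena.CardyFormulaZ2.Cruxes.HalfPlaneOneArmThird.IpPassageStirling

open Literature.Probability.Percolation Literature.Probability.LatticeModels

/-- Shifted factorials, cast to `ℝ`: `(n+k)! = (∏_{j<k} (n+j+1)) · n!`. -/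
private theorem cast_factorial_add (n k : ℕ) :
    ((n + k).factorial : ℝ) = (∏ j ∈ Finset.range k, ((n : ℝ) + j + 1)) * n.factorial := by
  induction k with
  | zero => simp
  | succ k ih =>
    rw [← Nat.add_assoc, Nat.factorial_succ, Nat.cast_mul, ih, Finset.prod_range_succ]
    push_cast; ring

/-- The CORE IDENTITY of Ikhlef–Ponsaing's products (arXiv:1202.5476, Prop. 4.7 ⇒ the two-step
recursion): with `a_i = (3i+2)(6i+3)!(2i+1)!/((4i+2)!(4i+3)!)` and
`n_i = (3i+1)(6i)!(2i)!/((4i)!(4i+1)!)`,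
`a_m · a_{m+1} · (3m+4)(4m+7)(6m+5) = n_{m+1}² · (3m+5)(4m+3)(6m+7)`. -/
private theorem ipCore (m : ℕ) :
    ((3 * m + 2 : ℕ) * (6 * m + 3).factorial * (2 * m + 1).factorial : ℝ) /
          ((4 * m + 2).factorial * (4 * m + 3).factorial : ℝ) *
        (((3 * (m + 1) + 2 : ℕ) * (6 * (m + 1) + 3).factorial * (2 * (m + 1) + 1).factorial : ℝ) /
          ((4 * (m + 1) + 2).factorial * (4 * (m + 1) + 3).factorial : ℝ)) *
        ((3 * (m : ℝ) + 4) * (4 * (m : ℝ) + 7) * (6 * (m : ℝ) + 5)) =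
      (((3 * (m + 1) + 1 : ℕ) * (6 * (m + 1)).factorial * (2 * (m + 1)).factorial : ℝ) /
          ((4 * (m + 1)).factorial * (4 * (m + 1) + 1).factorial : ℝ)) ^ 2 *
        ((3 * (m : ℝ) + 5) * (4 * (m : ℝ) + 3) * (6 * (m : ℝ) + 7)) := by
  have f69 : ((6 * (m + 1) + 3).factorial : ℝ) = ((6 * m + 3) + 6).factorial := by
    rw [show 6 * (m + 1) + 3 = 6 * m + 3 + 6 by ring]
  have f66 : ((6 * (m + 1)).factorial : ℝ) = ((6 * m + 3) + 3).factorial := by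
    rw [show 6 * (m + 1) = 6 * m + 3 + 3 by ring]
  have f23 : ((2 * (m + 1) + 1).factorial : ℝ) = ((2 * m + 1) + 2).factorial := by
    rw [show 2 * (m + 1) + 1 = 2 * m + 1 + 2 by ring]
  have f22 : ((2 * (m + 1)).factorial : ℝ) = ((2 * m + 1) + 1).factorial := by
    rw [show 2 * (m + 1) = 2 * m + 1 + 1 by ring]
  have f43 : ((4 * m + 3).factorial : ℝ) = ((4 * m + 2) + 1).factorial := by
    rw [show 4 * m + 3 = 4 * m + 2 + 1 by ring]
  have f46 : ((4 * (m + 1) + 2).factorial : ℝ) = ((4 * m + 2) + 4).factorial := by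
    rw [show 4 * (m + 1) + 2 = 4 * m + 2 + 4 by ring]
  have f47 : ((4 * (m + 1) + 3).factorial : ℝ) = ((4 * m + 2) + 5).factorial := by
    rw [show 4 * (m + 1) + 3 = 4 * m + 2 + 5 by ring]
  have f44 : ((4 * (m + 1)).factorial : ℝ) = ((4 * m + 2) + 2).factorial := by
    rw [show 4 * (m + 1) = 4 * m + 2 + 2 by ring]
  have f45 : ((4 * (m + 1) + 1).factorial : ℝ) = ((4 * m + 2) + 3).factorial := by
    rw [show 4 * (m + 1) + 1 = 4 * m + 2 + 3 by ring]
  have hX : ((6 * m + 3).factorial : ℝ) ≠ 0 := by positivity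
  have hY : ((2 * m + 1).factorial : ℝ) ≠ 0 := by positivity
  have hZ : ((4 * m + 2).factorial : ℝ) ≠ 0 := by positivity
  rw [f69, f66, f23, f22, f43, f46, f47, f44, f45]
  rw [cast_factorial_add (6 * m + 3), cast_factorial_add (6 * m + 3),
    cast_factorial_add (2 * m + 1), cast_factorial_add (2 * m + 1),
    cast_factorial_add (4 * m + 2), cast_factorial_add (4 * m + 2), cast_factorial_add (4 * m + 2),
    cast_factorial_add (4 * m + 2), cast_factorial_add (4 * m + 2)]
  simp only [Finset.prod_range_succ, Finset.prod_range_zero]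
  push_cast
  field_simp
  ring

/-- Generic product bookkeeping: if `a_m a_{m+1} D = n_{m+1}² R` and `n_{m+1} ≠ 0`, then the
closed forms `F(m) = A(m) A(m+1) / N(m+1)²` (`A(k) = ∏_{i<k} a_i`, `N(k) = ∏_{i<k} n_i`) satisfy
`F(m+1) · D = F(m) · R`. -/
private theorem prod_bridge (a n : ℕ → ℝ) (D R : ℝ) (m : ℕ) (hn : n (m + 1) ≠ 0)
    (h : a m * a (m + 1) * D = n (m + 1) ^ 2 * R) :
    (∏ i ∈ Finset.range (m + 1), a i) * (∏ i ∈ Finset.range (m + 1 + 1), a i) /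
          (∏ i ∈ Finset.range (m + 1 + 1), n i) ^ 2 * D =
      (∏ i ∈ Finset.range m, a i) * (∏ i ∈ Finset.range (m + 1), a i) /
          (∏ i ∈ Finset.range (m + 1), n i) ^ 2 * R := by
  simp only [Finset.prod_range_succ]
  set A := ∏ i ∈ Finset.range m, a i
  set N := ∏ i ∈ Finset.range m, n i
  calc A * a m * (A * a m * a (m + 1)) / (N * n m * n (m + 1)) ^ 2 * D
      = A * (A * a m) * R * n (m + 1) ^ 2 / ((N * n m) ^ 2 * n (m + 1) ^ 2) := by
        rw [mul_pow, div_mul_eq_mul_div]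
        congr 1
        linear_combination (A * (A * a m)) * h
    _ = A * (A * a m) * R / (N * n m) ^ 2 := mul_div_mul_right _ _ (pow_ne_zero 2 hn)
    _ = A * (A * a m) / (N * n m) ^ 2 * R := by ring

/-- **S1a (bridge).** Ikhlef–Ponsaing's first-passage closed form (the tree's named fact
`Literature.Probability.Percolation.IkhlefPonsaingFirstPassage`, arXiv:1202.5476 Prop. 4.7) implies
the two-step recursion of the wall-passage probability `P_b(2m+1)` of bond percolation on `ℤ²` at
`p = 1/2` in the diagonal strip `{0 ≤ v₀+v₁ ≤ 2m+1}`: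
`P_b(2m+3) · (3m+4)(4m+7)(6m+5) = P_b(2m+1) · (3m+5)(4m+3)(6m+7)`. -/
theorem stub_ipRecursion_of_ikhlefPonsaing :
    Literature.Probability.Percolation.IkhlefPonsaingFirstPassage →
    ∀ m : ℕ,
      (bondPercolation (zdGraph 2) half).real
          {ω | ∃ y : Site 2, y 0 + y 1 = 0 ∧
            ω ∈ openConnIn {v : Site 2 | 0 ≤ v 0 + v 1 ∧ v 0 + v 1 ≤ 2 * ((m + 1 : ℕ) : ℤ) + 1}
              ![2 * ((m + 1 : ℕ) : ℤ), 0] y} *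
        ((3 * (m : ℝ) + 4) * (4 * (m : ℝ) + 7) * (6 * (m : ℝ) + 5)) =
      (bondPercolation (zdGraph 2) half).real
          {ω | ∃ y : Site 2, y 0 + y 1 = 0 ∧
            ω ∈ openConnIn {v : Site 2 | 0 ≤ v 0 + v 1 ∧ v 0 + v 1 ≤ 2 * (m : ℤ) + 1}
              ![2 * (m : ℤ), 0] y} *
        ((3 * (m : ℝ) + 5) * (4 * (m : ℝ) + 3) * (6 * (m : ℝ) + 7)) := by
  intro hIP m
  have e1 : ((2 * m + 1 : ℕ) : ℤ) = 2 * (m : ℤ) + 1 := by push_cast; ring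
  have e2 : ((2 * (m + 1) + 1 : ℕ) : ℤ) = 2 * ((m + 1 : ℕ) : ℤ) + 1 := by push_cast; ring
  have h1 := hIP m ![2 * (m : ℤ), 0] (by simp)
  have h2 := hIP (m + 1) ![2 * ((m + 1 : ℕ) : ℤ), 0] (by simp)
  rw [e1] at h1
  rw [e2] at h2
  rw [h1, h2]
  refine prod_bridge _ _ _ _ m ?_ (ipCore m)
  positivity

end Summit.CriticalPhenomena.CardyFormulaZ2.Cruxes.HalfPlaneOneArmThird.IpPassageStirling

end
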